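import Literature.MathematicalPhysics.QuantumFieldTheory.Balaban1985CMP102.Setting
import Literature.MathematicalPhysics.QuantumFieldTheory.Balaban1983to89.LogChartClosedSubgroup
import Literature.Algebra.Lie.CompactKillingForm

/-!
# Lane `pub-balaban3d` — carrier layer p1, part 5 (`Carriers.Group`): the printed hypotheses on the gauge group
# (`…Balaban1985CMP102.Setting.GroupModel`: «a semi-simple compact group Lie G», [Balaban1985UV3] Thm 1 p. 257; «a Lie subgroup G
# of a unitary group U(N)», [Balaban1985Averaging] p. 18) — CONSEQUENCES (regularity of the group for the measure theory of the
# run) and INHABITANTS (`SU(N)`, `N ≥ 1`)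

WHAT IS PROVED ([folklore]; nothing of CMP 102 is asserted):
* §1 `groupModel_regularGaugeGroup`: every group AS PRINTED is a `UnitaryModel.RegularGaugeGroup` — multiplication, inversion,
  `|· − 1|`, `Re tr` are measurable for the Borel structure pulled back along the faithful unitary realisation `ρ`, and
  `|Re tr| ≤ 1`.  Hence the carrier theorems of `Carriers.RT`/`Carriers.Run` ((6) for `run3`, integrability of ρ_k, …) hold for
  EVERY `(G, GroupModel G)` the spine's Theorem 1 quantifies over.
* §2 `suGroupModel N : GroupModel (Matrix.specialUnitaryGroup (Fin N) ℂ)` (`N ≥ 1`): the spine's group hypotheses are satisfied by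
  `SU(N)` with its fundamental realisation, its Borel structure (tree `Matrix.specialUnitaryGroup.instMeasurableSpace = borel`), the
  Lie algebra `𝔰𝔲(N)` of the tree (`Literature.Algebra.Lie.CompactKillingForm.su`, semisimple there:
  `instIsSemisimpleSu`), and Hall's characterisation `𝔰𝔲(N) = {X | e^{tX} ∈ SU(N) ∀ t ∈ ℝ}` (tree
  `LogChartClosedSubgroup.mem_su_iff_forall_exp_mem_specialUnitaryGroup`).  NON-VACUITY of `Theorems.Thm1AsPrinted`'s group binder.
-/

open MeasureTheory
open scoped Matrix

namespace Summit.QuantumFields.Balaban3D.Carriers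

open Literature.MathematicalPhysics.QuantumFieldTheory.Balaban1983to89
open Literature.MathematicalPhysics.QuantumFieldTheory.Balaban1985CMP102.Setting

/-! ## §1 A group as printed is a regular gauge group -/

namespace GroupModelRegularity

variable {G : Type} [GaugeGroup G] [MeasurableSpace G]

/-- Measurability INTO `G` is measurability of the matrix realisation (the σ-algebra of `G` is pulled back along `ρ`). [folklore] -/
theorem measurable_iff (𝔊 : GroupModel G) {X : Type*} [MeasurableSpace X] (f : X → G) :
    Measurable f ↔ @Measurable X (Matrix (Fin 𝔊.N) (Fin 𝔊.N) ℂ) _ (borel _) (𝔊.ρ ∘ f) := by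
  have hm : (‹MeasurableSpace G›) = MeasurableSpace.comap 𝔊.ρ (borel (Matrix (Fin 𝔊.N) (Fin 𝔊.N) ℂ)) :=
    𝔊.measurableSpace_eq
  constructor
  · intro hf
    have hρ : @Measurable G (Matrix (Fin 𝔊.N) (Fin 𝔊.N) ℂ) _ (borel _) 𝔊.ρ := by
      rw [measurable_iff_comap_le, ← hm]
    exact hρ.comp hf
  · intro h
    rw [measurable_iff_comap_le] at h ⊢
    rw [hm, MeasurableSpace.comap_comp]
    exact h

/-- The realisation `ρ : G → M_N(ℂ)` is Borel measurable. [folklore] -/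
theorem measurable_rho (𝔊 : GroupModel G) : @Measurable G (Matrix (Fin 𝔊.N) (Fin 𝔊.N) ℂ) _ (borel _) 𝔊.ρ :=
  (measurable_iff 𝔊 id).1 measurable_id

/-- Multiplication on a group as printed is jointly measurable (matrix multiplication is continuous; `M_N(ℂ)` is second
countable). [folklore] -/
theorem measurableMul₂ (𝔊 : GroupModel G) : MeasurableMul₂ G := by
  letI : MeasurableSpace (Matrix (Fin 𝔊.N) (Fin 𝔊.N) ℂ) := borel _
  haveI : BorelSpace (Matrix (Fin 𝔊.N) (Fin 𝔊.N) ℂ) := ⟨rfl⟩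
  haveI : SecondCountableTopology (Matrix (Fin 𝔊.N) (Fin 𝔊.N) ℂ) := secondCountableTopology_matrix
  refine ⟨?_⟩
  rw [measurable_iff 𝔊]
  have hfun : 𝔊.ρ ∘ (fun p : G × G => p.1 * p.2) = fun p => 𝔊.ρ p.1 * 𝔊.ρ p.2 := by
    funext p; simp [map_mul]
  rw [hfun]
  have h1 : Measurable fun p : G × G => 𝔊.ρ p.1 := (measurable_iff 𝔊 Prod.fst).1 measurable_fst
  have h2 : Measurable fun p : G × G => 𝔊.ρ p.2 := (measurable_iff 𝔊 Prod.snd).1 measurable_snd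
  exact h1.mul h2

/-- Inversion on a group as printed is measurable (`ρ(g⁻¹) = ρ(g)ᴴ`, adjoint continuous). [folklore] -/
theorem measurableInv (𝔊 : GroupModel G) : MeasurableInv G := by
  letI : MeasurableSpace (Matrix (Fin 𝔊.N) (Fin 𝔊.N) ℂ) := borel _
  haveI : BorelSpace (Matrix (Fin 𝔊.N) (Fin 𝔊.N) ℂ) := ⟨rfl⟩
  refine ⟨?_⟩
  rw [measurable_iff 𝔊]
  have hfun : 𝔊.ρ ∘ (fun g : G => g⁻¹) = fun g => (𝔊.ρ g)ᴴ := by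
    funext g; exact UnitaryModel.map_inv_eq_conjTranspose 𝔊.ρ 𝔊.mem_unitary g
  rw [hfun]
  exact (continuous_id.matrix_conjTranspose).measurable.comp (measurable_rho 𝔊)

/-- `|· − 1|` is measurable on a group as printed. [folklore] -/
theorem measurable_dist1 (𝔊 : GroupModel G) : Measurable (dist1 : G → ℝ) := by
  letI : MeasurableSpace (Matrix (Fin 𝔊.N) (Fin 𝔊.N) ℂ) := borel _
  haveI : BorelSpace (Matrix (Fin 𝔊.N) (Fin 𝔊.N) ℂ) := ⟨rfl⟩
  have hfun : (dist1 : G → ℝ) = UnitaryModel.opDist1 ∘ 𝔊.ρ := funext 𝔊.dist1_eq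
  rw [hfun]
  exact UnitaryModel.continuous_opDist1.measurable.comp (measurable_rho 𝔊)

/-- `Re tr` is measurable on a group as printed. [folklore] -/
theorem measurable_reTr (𝔊 : GroupModel G) : Measurable (reTr : G → ℝ) := by
  letI : MeasurableSpace (Matrix (Fin 𝔊.N) (Fin 𝔊.N) ℂ) := borel _
  haveI : BorelSpace (Matrix (Fin 𝔊.N) (Fin 𝔊.N) ℂ) := ⟨rfl⟩
  have hfun : (reTr : G → ℝ) = UnitaryModel.nReTr ∘ 𝔊.ρ := funext 𝔊.reTr_eq
  rw [hfun]
  exact UnitaryModel.continuous_nReTr.measurable.comp (measurable_rho 𝔊)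

end GroupModelRegularity

/-- **A GROUP AS PRINTED IS A REGULAR GAUGE GROUP** (`UnitaryModel.RegularGaugeGroup`): measurable group operations and interface
functions, `|Re tr| ≤ 1`.  With it, `Carriers.Run.run3_eq6` and the integrability of the densities hold for every group the
spine's Theorem 1 quantifies over. [folklore] -/
theorem groupModel_regularGaugeGroup {G : Type} [GaugeGroup G] [MeasurableSpace G] (𝔊 : GroupModel G) :
    RegularGaugeGroup G where
  toMeasurableMul₂ := GroupModelRegularity.measurableMul₂ 𝔊
  toMeasurableInv := GroupModelRegularity.measurableInv 𝔊
  measurable_dist1 := GroupModelRegularity.measurable_dist1 𝔊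
  measurable_reTr := GroupModelRegularity.measurable_reTr 𝔊
  abs_reTr_le_one g := by rw [𝔊.reTr_eq]; exact UnitaryModel.abs_nReTr_le_one (𝔊.mem_unitary g)

/-! ## §2 `SU(N)` satisfies the printed group hypotheses -/

section SUN

open Literature.MathematicalPhysics.QuantumLattice
open Literature.Algebra.Lie

variable (N : ℕ)

/-- **`SU(N)` AS A GROUP AS PRINTED** ([Balaban1985UV3] Thm 1 «semi-simple compact group Lie G», [Balaban1985Averaging] p. 18 «Lie
subgroup G of a unitary group U(N)»): fundamental realisation, closed range (compact image), the tree's Borel structure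
(= the pull-back of the Borel structure of `M_N(ℂ)`), Lie algebra `𝔰𝔲(N)` with Hall's one-parameter characterisation, semisimple. [folklore] -/
noncomputable def suGroupModel [NeZero N] : GroupModel (Matrix.specialUnitaryGroup (Fin N) ℂ) where
  N := N
  N_pos := Nat.pos_of_ne_zero (NeZero.ne N)
  ρ := fundamentalRep (Fin N)
  mem_unitary := fundamentalRep_mem_unitaryGroup
  injective := fundamentalRep_injective (Fin N)
  isClosed_range := (isCompact_range (continuous_fundamentalRep (Fin N))).isClosed
  dist1_eq := fun _ => rfl
  reTr_eq := fun _ => rfl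
  measurableSpace_eq := borel_comap
  lie := CompactKillingForm.su (Fin N)
  mem_lie_iff X := by
    rw [CompactKillingForm.mem_su_iff]
    have h := LogChartClosedSubgroup.mem_su_iff_forall_exp_mem_specialUnitaryGroup (n := Fin N) (X := X)
    rw [Matrix.star_eq_conjTranspose] at h
    rw [h]
    refine forall_congr' fun t => ?_
    rw [show (t : ℂ) • X = t • X from (RCLike.real_smul_eq_coe_smul (K := ℂ) t X).symm]
    constructor
    · intro ht; exact ⟨⟨_, ht⟩, rfl⟩
    · rintro ⟨U, hU⟩; rw [← hU]; exact U.2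
  semisimple := inferInstance

/-- Non-vacuity of the group binder of the spine's Theorem 1: a group as printed exists (`SU(2)`). [folklore] -/
theorem nonempty_groupModel_su2 : Nonempty (GroupModel (Matrix.specialUnitaryGroup (Fin 2) ℂ)) := ⟨suGroupModel 2⟩

/-- The dimension `d(𝔤)` of the Lie algebra of a group as printed ((18) p. 260 «d(𝔤) = dim 𝔤», entering `log σ₀|Ω₁*| +
d(𝔤) log g₀|Ω₁*|` of (22) p. 261 and (62) p. 271), as a natural number. [cite: Balaban1985UV3, (22) p.261] -/
noncomputable def GroupModel.dimLie {G : Type} [GaugeGroup G] [MeasurableSpace G] (𝔊 : GroupModel G) : ℕ :=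
  Module.finrank ℝ 𝔊.lie

end SUN

end Summit.QuantumFields.Balaban3D.Carriers
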